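import Summits.NavierStokesRegularity.NavierStokesRegularity.Theses.AxisymmetricExtremality
import Summits.NavierStokesRegularity.NavierStokesRegularity.Theorems.AxisymmetricExtremalityAxisymmetricKatoGlobalStubSereginLogSwirlOriginStep3StreamForm
import Summits.NavierStokesRegularity.NavierStokesRegularity.Theorems.AxisymmetricExtremalityAxisymmetricKatoGlobalStubSereginLogSwirlOriginStep3SwirlSource
import HarnessLib

/-!
# Seregin 2022, §2 Step 3: the bound of `A₃ = ∫ η⁶Φ ω·∇(v_r/r)` by the swirl decay (2.2), the
# log-Hardy inequality (Lemma 2.2) and Lemma 2.1 (ii) (numeric), with explicit constants —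
# crux stmt-NavierStokesRegularity-15453 (`AxisymmetricExtremality.AxisymmetricKatoGlobal`), line registered, support for stub `stub_sereginLogSwirlOrigin`

Support file (`--supports stmt-NavierStokesRegularity-15453`; theorems only, everything proved)
toward the registered stub `stub_sereginLogSwirlOrigin` = the named fact
`Literature.Analysis.FluidPDE.seregin2022_logSwirl_regularAtOrigin` (G. Seregin, J. Math. Fluid
Mech. 24 (2022), Paper 27 = arXiv:2201.00153, §2). Step 3, arXiv pp. 6–7: `A₃ = A₃₁ + A₃₂`,
`A₃₁ = A₀ + A'₃₁` with `A₀ = ∫(v_θ(η³v_r/r),₃(η³Φ),ᵣ − v_θ(η³v_r/r),ᵣ(η³Φ),₃)`,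
"`A'₃₁ ≤ C(v,η)‖∇(η³Φ)‖`", "`A₀ ≤ cC₁²(∫ (1/(r²ln⁶(e/|x'|)))(|(η³v_r/r),₃|² + |(η³v_r/r),ᵣ|²))^{1/2}
‖∇(η³Φ)‖ ≤ (cC₁²/ln⁴(e/|r₁|))(∫(1/(r²ln²))(…))^{1/2}‖∇(η³Φ)‖ + C(v,η,r₁)` … we again apply
Lemma 2.2 … It remains to take into account the statement of Lemma 2.1 and conclude
`A₀ ≤ (cC₁²/ln⁴(e/|r₁|))‖η³∇Γ‖‖η³∇Φ‖ + C(v,η,r₁)(‖η³∇Γ‖ + ‖η³∇Φ‖) + C(v,η,r₁)`",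
"`A₃₂ ≤ C(v,η)`".

* `two_mul_integral_sourcePhi_le` (registered sub-goal) — **the `A₃` bound** at a fixed time, for an
  axisymmetric `u ∈ C⁴` (`W = v_r/r = radVelQuot u`, `Φ = ω_r/r = radVelQuot (curl u)`,
  `Γ = ω_θ/r = angVortQuot u`, `v_θ = swirlVelocity u`) and an axisymmetric cut-off `ζ = η³ ∈ C²`
  supported in `𝒞 = spaceCyl 0 1`, in the form consumed by `cutoff_energy_apriori`
  (`…Step3Absorb`): for every `ε > 0`,
  `2∫ζ²Φ DW[ω] ≤ (C₁(1 + 4c_L)/ln²(e/r₁) + 4ε)(∫|∇(ζΓ)|² + ∫|∇(ζΦ)|²)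
    + 4C₁C_L/ln²(e/r₁) + ((P₀² + P₁²)/(2ε) + 2P₂)|B(0,2)|`.
  Route: the stream form `∫ζ²Φ DW[ω] = ∫⟪u, ∇(ζ·ζΦ) × ∇W⟫` (`…Step3StreamForm`) and the
  decomposition `∇(ζ·ζΦ) × ∇W = ∇(ζΦ) × ∇(ζW) − W ∇(ζΦ) × ∇ζ + (ζΦ) ∇ζ × ∇W` (`A₀, A'₃₁, A₃₂`);
  a.e. (off the axis) only `v_θ` pairs with each cross product (`abs_inner_cross_gradient_le`);
  near the axis (2.2) gives `|v_θ| ≤ C₁/(r ln³(e/r))` (`abs_swirlVelocity_le_of_swirl_le`), so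
  `|v_θ||∇(ζΦ)||∇(ζW)| ≤ (C₁/(2ln²(e/r₁)))(|∇(ζΦ)|² + |∇(ζW)|²/(r²ln²(e/r)))`; away from it and on
  `supp ∇ζ` the pointwise bounds `P₀ ≥ |v_θ||∇(ζW)|` (`r ≥ r₁`), `P₁ ≥ |W||v_θ||∇ζ|`,
  `P₂ ≥ |ζΦ||v_θ||∇ζ||∇W|` (the paper's `C(v,η,r₁)`) and Young; Lemma 2.2
  (`integrable_and_integral_sq_div_logWeight_le`) on the components `∂ᵢ(ζW)` gives
  `∫|∇(ζW)|²/(r²ln²) ≤ 4∫|∇²(ζW)|²`, and Lemma 2.1 (ii) enters as the numeric hypothesis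
  `∫|∇²(ζW)|² ≤ c_L∫|∇(ζΓ)|² + C_L` (its printed form `‖∇̄²(η³v_r/r)‖ ≤ c‖η³Γ,₃‖ + C`, squared;
  global core `eLpNorm_fderiv_fderiv_radVelQuot_le_eLpNorm_fderiv_angVortQuot`, `…CFZBounds`).

With `…Step3Absorb` this closes Step 3 up to the two elementary constants `Bcut`
(cut-off terms) and `P₀, P₁, P₂` and Lemma 2.1 (ii) in localised form.

## Mathlib / tree search

Tree: `integral_mul_fderiv_apply_curl_eq`, `abs_inner_cross_gradient_le`, `near_axis_scalar`,
`pointwise_scalar`, `final_scalar` (`…Step3StreamForm`), private copies of `‖∇g‖ = ‖Dg‖`,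
`∇(pq) = p∇q + q∇p` (`norm_gradient_eq_norm_fderiv`, `Seregin2020.gradient_mul_apply'` in the tree), `log_exp_div_eq` (`…Step3SwirlSource`),
`integrable_and_integral_sq_div_logWeight_le`, `spaceCyl_subset_closedBall` (`…LerayLogHardy`),
`abs_swirlVelocity_le_of_swirl_le` (`…Step13Tools`), `hasCompactSupport_of_eq_zero`,
`continuous_fderiv_apply_of_contDiff` (`…Step3CutoffCalculus`), `norm_gradient_sq`,
`contDiff_radVelQuot / angVortQuot`, `IsAxisymmetric.isAxisymmetricScalar_radVelQuot`, `.curl`,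
`volume_setOf_cylRadius_eq_zero`. Mathlib: `integral_mono_ae`, `abs_integral_le_integral_abs`,
`integral_indicator_one`, `tsupport_fderiv_apply_subset`, `tsupport_mul_subset_left`,
`fderiv_of_notMem_tsupport`. `lean search 'sourcePhi'`: no matches (2026-08-17).

## References

* G. Seregin, J. Math. Fluid Mech. 24 (2022), Paper No. 27 = arXiv:2201.00153, §2 Step 3
  (arXiv pp. 6–7, the estimates of `A₀`, `A'₃₁`, `A₃₂`). [`Seregin2022LocalAxisym`]
-/

noncomputable section

open MeasureTheory Set Filter Topology Function Metric
open scoped ENNReal ContDiff RealInnerProductSpace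
open Literature.Analysis.FluidPDE

-- `<Problem> = <Summit>` duplicates a namespace component by design (lakefile sets the same option).
set_option linter.dupNamespace false

namespace Summit.NavierStokesRegularity.NavierStokesRegularity.Theorems.AxisymmetricKatoGlobal.EulerScaling

section A3

/-- `‖∇g(x)‖ = ‖Dg(x)‖`. [folklore] -/
private theorem norm_gradient_eq_norm_fderiv' (g : EuclideanSpace ℝ (Fin 3) → ℝ) (x : EuclideanSpace ℝ (Fin 3)) :
    ‖gradient g x‖ = ‖fderiv ℝ g x‖ := by
  rw [gradient, LinearIsometryEquiv.norm_map]

/-- `∇(pq) = p∇q + q∇p`. [folklore] -/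
private theorem gradient_mul_apply {p q : EuclideanSpace ℝ (Fin 3) → ℝ} {x : EuclideanSpace ℝ (Fin 3)}
    (hp : DifferentiableAt ℝ p x) (hq : DifferentiableAt ℝ q x) :
    gradient (fun y => p y * q y) x = p x • gradient q x + q x • gradient p x := by
  simp only [gradient, fderiv_fun_mul hp hq, map_add, map_smul]

set_option maxHeartbeats 800000 in
/-- **Seregin 2022, §2 Step 3, the bound of `A₃`** (arXiv pp. 6–7: `A₃ = A₃₁ + A₃₂`,
`A₃₁ = A₀ + A'₃₁`, "`A₀ ≤ (cC₁²/ln⁴(e/r₁))(‖∇_{x'}(η³v_r/r),₃‖² + ‖∇_{x'}(η³v_r/r),ᵣ‖²)^{1/2}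
‖∇(η³Φ)‖ + C(v,η,r₁)` … It remains to take into account the statement of Lemma 2.1 and conclude
`A₃ ≤ (cC₁²/ln⁴(e/r₁))‖η³∇Γ‖‖η³∇Φ‖ + C(v,η,r₁)(‖η³∇Γ‖ + ‖η³∇Φ‖) + C(v,η,r₁)`"), at a fixed
time, with explicit constants, in the form consumed by `cutoff_energy_apriori`. For an axisymmetric
`u ∈ C⁴` (`W = v_r/r = radVelQuot u`, `Φ = ω_r/r = radVelQuot (curl u)`, `Γ = ω_θ/r = angVortQuot u`,
`v_θ = swirlVelocity u`) and an axisymmetric cut-off `ζ = η³ ∈ C²` supported in `𝒞`: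
by the stream form `A₃ = ∫⟪u, ∇(ζ²Φ) × ∇W⟫` and `∇(ζ²Φ) × ∇W = ∇(ζΦ) × ∇(ζW) − W∇(ζΦ) × ∇ζ
+ (ζΦ)∇ζ × ∇W` (`= A₀ + A'₃₁ + A₃₂`), where only `v_θ` pairs with each cross product
(`abs_inner_cross_gradient_le`); near the axis (2.2) gives `|v_θ| ≤ C₁/(r ln³(e/r))` and Lemma 2.2
applied to the components of `∇(ζW)` brings in `∫|∇²(ζW)|²`, bounded by Lemma 2.1 (ii) taken as
the numeric hypothesis `∫|∇²(ζW)|² ≤ c_L ∫|∇(ζΓ)|² + C_L` (its printed form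
`‖∇̄²(η³v_r/r)‖ ≤ c‖η³Γ,₃‖ + C`, squared); away from the axis and on `supp ∇ζ` the pointwise
bounds `P₀, P₁, P₂` (the paper's `C(v,η,r₁)`: boundedness of `v, ∇v, ∇²v` there). Result:
`2A₃ ≤ (C₁(1 + 4c_L)/ln²(e/r₁) + 4ε)(∫|∇(ζΓ)|² + ∫|∇(ζΦ)|²)
  + 4C₁C_L/ln²(e/r₁) + ((P₀² + P₁²)/(2ε) + 2P₂)|B(0,2)|` for every `ε > 0`.
[cite: Seregin2022LocalAxisym, §2 Step 3 (arXiv:2201.00153 pp. 6–7, the estimates of A₀, A'₃₁, A₃₂)] -/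
theorem two_mul_integral_sourcePhi_le : ∀ (u : EuclideanSpace ℝ (Fin 3) → EuclideanSpace ℝ (Fin 3)) (ζ : EuclideanSpace ℝ (Fin 3) → ℝ) (C₁ r₁ ε P₀ P₁ P₂ cL CL : ℝ), IsAxisymmetric u → ContDiff ℝ 4 u → ContDiff ℝ 2 ζ → IsAxisymmetricScalar ζ → tsupport ζ ⊆ SereginSverak2009.spaceCyl 0 1 → 0 ≤ C₁ → 0 < r₁ → r₁ < 1 → 0 < ε → 0 ≤ P₂ → 0 ≤ cL → (∀ x, 0 < cylRadius x → cylRadius x < r₁ → |swirl u x| ≤ C₁ / Real.log (Real.exp 1 / cylRadius x) ^ 3) → (∀ x, r₁ ≤ cylRadius x → |swirlVelocity u x| * ‖fderiv ℝ (fun y => ζ y * radVelQuot u y) x‖ ≤ P₀) → (∀ x, |radVelQuot u x| * |swirlVelocity u x| * ‖fderiv ℝ ζ x‖ ≤ P₁) → (∀ x, |ζ x * radVelQuot (curl u) x| * |swirlVelocity u x| * (‖fderiv ℝ ζ x‖ * ‖fderiv ℝ (radVelQuot u) x‖) ≤ P₂) → (∫ x, ∑ i : Fin 3, ∑ j : Fin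 3, (fderiv ℝ (fun y => fderiv ℝ (fun y => ζ y * radVelQuot u y) y (EuclideanSpace.single i 1)) x (EuclideanSpace.single j 1)) ^ 2) ≤ cL * (∫ x, (fderiv ℝ (fun y => ζ y * angVortQuot u y) x (EuclideanSpace.single 0 1) ^ 2 + fderiv ℝ (fun y => ζ y * angVortQuot u y) x (EuclideanSpace.single 1 1) ^ 2 + fderiv ℝ (fun y => ζ y * angVortQuot u y) x (EuclideanSpace.single 2 1) ^ 2)) + CL → 2 * ∫ x, ζ x ^ 2 * radVelQuot (curl u) x * fderiv ℝ (radVelQuot u) x (curl u x) ≤ (C₁ * (1 + 4 * cL) / Real.log (Real.exp 1 / r₁) ^ 2 + 4 * ε) * ((∫ x, (fderiv ℝ (fun y => ζ y * angVortQuot u y) x (EuclideanSpace.single 0 1) ^ 2 + fderiv ℝ (fun y => ζ y * angVortQuot u y) x (EuclideanSpace.single 1 1) ^ 2 + fderiv ℝ (fun y => ζ y * angVortQuot u y) x (EuclideanSpace.single 2 1) ^ 2)) + (∫ x, (fderiv ℝ (fun y => ζ y * radVelQuot (curl u) y) x (EuclideanSpace.single 0 1) ^ 2 + fderiv ℝ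 (fun y => ζ y * radVelQuot (curl u) y) x (EuclideanSpace.single 1 1) ^ 2 + fderiv ℝ (fun y => ζ y * radVelQuot (curl u) y) x (EuclideanSpace.single 2 1) ^ 2))) + (4 * C₁ * CL / Real.log (Real.exp 1 / r₁) ^ 2 + ((P₀ ^ 2 + P₁ ^ 2) / (2 * ε) + 2 * P₂) * volume.real (closedBall (0 : EuclideanSpace ℝ (Fin 3)) 2)) := by
  intro u ζ C₁ r₁ ε P₀ P₁ P₂ cL CL hax hu hζ hζax hζs hC₁ hr₁ hr₁1 hε hP₂ hcL hσ hfar hP1 hP2 hL21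
  -- regularity
  have hu1 : ContDiff ℝ 1 u := hu.of_le (by norm_num)
  have hu2 : ContDiff ℝ 2 u := hu.of_le (by norm_num)
  have hω : ContDiff ℝ 3 (curl u) := contDiff_curl (n := 3) (by exact_mod_cast hu)
  have hW : ContDiff ℝ 2 (radVelQuot u) := contDiff_radVelQuot (n := 2) (by exact_mod_cast hu)
  have hΦ : ContDiff ℝ 1 (radVelQuot (curl u)) := contDiff_radVelQuot (n := 1) (by exact_mod_cast hω)
  have hΓ : ContDiff ℝ 1 (angVortQuot u) := contDiff_angVortQuot (n := 1) (by exact_mod_cast hu.of_le (by norm_num))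
  have hWax : IsAxisymmetricScalar (radVelQuot u) := hax.isAxisymmetricScalar_radVelQuot hu2
  have haxω : IsAxisymmetric (curl u) := hax.curl (hu1.differentiable one_ne_zero)
  have hΦax : IsAxisymmetricScalar (radVelQuot (curl u)) :=
    haxω.isAxisymmetricScalar_radVelQuot (hω.of_le (by norm_num))
  have hζ1 : ContDiff ℝ 1 ζ := hζ.of_le (by norm_num)
  have hζd : Differentiable ℝ ζ := hζ1.differentiable one_ne_zero
  have hWd : Differentiable ℝ (radVelQuot u) := hW.differentiable two_ne_zero
  have hΦd : Differentiable ℝ (radVelQuot (curl u)) := hΦ.differentiable one_ne_zero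
  have hζc : HasCompactSupport ζ :=
    IsCompact.of_isClosed_subset (isCompact_closedBall (0 : EuclideanSpace ℝ (Fin 3)) 2)
      (isClosed_tsupport ζ) (hζs.trans spaceCyl_subset_closedBall)
  have hζzero : ∀ x, x ∉ closedBall (0 : EuclideanSpace ℝ (Fin 3)) 2 → ζ x = 0 := fun x hx =>
    image_eq_zero_of_notMem_tsupport fun h => hx (spaceCyl_subset_closedBall (hζs h))
  -- the three product functions
  have hF : ContDiff ℝ 2 (fun y => ζ y * radVelQuot u y) := hζ.mul hW
  have hF1 : ContDiff ℝ 1 (fun y => ζ y * radVelQuot u y) := hF.of_le (by norm_num)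
  have hH : ContDiff ℝ 1 (fun y => ζ y * radVelQuot (curl u) y) := hζ1.mul hΦ
  have hG1 : ContDiff ℝ 1 (fun y => ζ y * angVortQuot u y) := hζ1.mul hΓ
  have hFax : IsAxisymmetricScalar (fun y => ζ y * radVelQuot u y) := hζax.mul hWax
  have hHax : IsAxisymmetricScalar (fun y => ζ y * radVelQuot (curl u) y) := hζax.mul hΦax
  have hFd : Differentiable ℝ (fun y => ζ y * radVelQuot u y) := hF1.differentiable one_ne_zero
  have hHd : Differentiable ℝ (fun y => ζ y * radVelQuot (curl u) y) := hH.differentiable one_ne_zero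
  have hHc : HasCompactSupport (fun y => ζ y * radVelQuot (curl u) y) := hζc.mul_right
  have hFc : HasCompactSupport (fun y => ζ y * radVelQuot u y) := hζc.mul_right
  -- the stream form, with `f = ζ²Φ = ζ · (ζΦ)`
  have hf1 : ContDiff ℝ 1 fun y => ζ y * (ζ y * radVelQuot (curl u) y) := hζ1.mul hH
  have hfc : HasCompactSupport fun y => ζ y * (ζ y * radVelQuot (curl u) y) := hζc.mul_right
  have hstream := integral_mul_fderiv_apply_curl_eq u _ _ hu1 hf1 hfc hW
  have hLHS : ∫ x, ζ x ^ 2 * radVelQuot (curl u) x * fderiv ℝ (radVelQuot u) x (curl u x) =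
      ∫ x, ζ x * (ζ x * radVelQuot (curl u) x) * fderiv ℝ (radVelQuot u) x (curl u x) :=
    integral_congr_ae (Eventually.of_forall fun x => by ring)
  rw [hLHS, hstream]
  -- the pointwise decomposition `∇(ζ·ζΦ) × ∇W = c₀ − W c₁ + (ζΦ) c₂`
  have hdec : ∀ x, ⟪u x, cross (gradient (fun y => ζ y * (ζ y * radVelQuot (curl u) y)) x)
      (gradient (radVelQuot u) x)⟫ =
      ⟪u x, cross (gradient (fun y => ζ y * radVelQuot (curl u) y) x) (gradient (fun y => ζ y * radVelQuot u y) x)⟫ -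
        radVelQuot u x * ⟪u x, cross (gradient (fun y => ζ y * radVelQuot (curl u) y) x) (gradient ζ x)⟫ +
        (ζ x * radVelQuot (curl u) x) * ⟪u x, cross (gradient ζ x) (gradient (radVelQuot u) x)⟫ := by
    intro x
    rw [gradient_mul_apply (hζd x) (hHd x), gradient_mul_apply (hζd x) (hWd x)]
    simp only [← crossCLM_apply, map_add, map_smul, _root_.add_apply,
      _root_.FunLike.coe_smul, Pi.smul_apply, inner_add_right, inner_smul_right]
    ring
  -- abbreviations
  set T : EuclideanSpace ℝ (Fin 3) → ℝ := fun x => ⟪u x, cross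
    (gradient (fun y => ζ y * (ζ y * radVelQuot (curl u) y)) x) (gradient (radVelQuot u) x)⟫ with hT
  set L₁ : ℝ := Real.log (Real.exp 1 / r₁) with hL₁
  have hL₁1 : 1 < L₁ := by
    rw [hL₁, log_exp_div_eq r₁ hr₁]; linarith [Real.log_neg hr₁ hr₁1]
  have hL₁0 : 0 < L₁ := by linarith
  set χ : EuclideanSpace ℝ (Fin 3) → ℝ := (closedBall (0 : EuclideanSpace ℝ (Fin 3)) 2).indicator 1 with hχ
  have hχi : Integrable χ := by
    rw [hχ]
    exact (integrable_indicator_iff measurableSet_closedBall).2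
      ((integrableOn_const_iff).2 (Or.inr (isCompact_closedBall _ _).measure_lt_top))
  have hχ0 : ∀ x, 0 ≤ χ x := fun x => by rw [hχ]; exact indicator_nonneg (fun _ _ => zero_le_one) x
  have hχint : ∫ x, χ x = volume.real (closedBall (0 : EuclideanSpace ℝ (Fin 3)) 2) := by rw [hχ]; exact integral_indicator_one measurableSet_closedBall
  -- the components `gᵢ = ∂ᵢ(ζW)` and Lemma 2.2 for them
  obtain ⟨g, hg⟩ : ∃ g : Fin 3 → EuclideanSpace ℝ (Fin 3) → ℝ,
      g = fun i x => fderiv ℝ (fun y => ζ y * radVelQuot u y) x (EuclideanSpace.single i 1) := ⟨_, rfl⟩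
  have hgx : ∀ i x, g i x = fderiv ℝ (fun y => ζ y * radVelQuot u y) x (EuclideanSpace.single i 1) :=
    fun i x => by rw [hg]
  have hgi : ∀ i, ContDiff ℝ 1 (g i) := fun i => by
    rw [hg]; exact contDiff_fderiv_apply_const_succ (n := 1) (by exact_mod_cast hF) _
  have hFs : tsupport (fun y => ζ y * radVelQuot u y) ⊆ tsupport ζ := tsupport_mul_subset_left
  have hgs : ∀ i, tsupport (g i) ⊆ SereginSverak2009.spaceCyl 0 1 := fun i => by
    have h1 : tsupport (fun x => fderiv ℝ (fun y => ζ y * radVelQuot u y) x (EuclideanSpace.single i 1)) ⊆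
        tsupport (fun y => ζ y * radVelQuot u y) :=
      tsupport_fderiv_apply_subset ℝ (EuclideanSpace.single i 1)
    rw [hg]
    exact (h1.trans hFs).trans hζs
  have hL22 := fun i => integrable_and_integral_sq_div_logWeight_le (hgi i) (hgs i)
  obtain ⟨Q, hQ⟩ : ∃ Q : Fin 3 → EuclideanSpace ℝ (Fin 3) → ℝ,
      Q = fun i x => g i x ^ 2 / (cylRadius x ^ 2 * Real.log (Real.exp 1 / cylRadius x) ^ 2) := ⟨_, rfl⟩
  have hQx : ∀ i x, Q i x = g i x ^ 2 / (cylRadius x ^ 2 * Real.log (Real.exp 1 / cylRadius x) ^ 2) :=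
    fun i x => by rw [hQ]
  have hQi : ∀ i, Integrable (Q i) := fun i => by rw [hQ]; exact (hL22 i).1
  have hQle : ∀ i, ∫ x, Q i x ≤ 4 * ∫ x, (fderiv ℝ (g i) x (EuclideanSpace.single 0 1) ^ 2 +
      fderiv ℝ (g i) x (EuclideanSpace.single 1 1) ^ 2) := fun i => by rw [hQ]; exact (hL22 i).2
  have hQ0 : ∀ i x, 0 ≤ Q i x := fun i x => by rw [hQx]; positivity
  -- the full gradient squared of `ζΦ`
  obtain ⟨A, hA⟩ : ∃ A : EuclideanSpace ℝ (Fin 3) → ℝ, A = fun x =>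
      (fderiv ℝ (fun y => ζ y * radVelQuot (curl u) y) x (EuclideanSpace.single 0 1) ^ 2 +
        fderiv ℝ (fun y => ζ y * radVelQuot (curl u) y) x (EuclideanSpace.single 1 1) ^ 2 +
        fderiv ℝ (fun y => ζ y * radVelQuot (curl u) y) x (EuclideanSpace.single 2 1) ^ 2) := ⟨_, rfl⟩
  have hAi : Integrable A := by
    have hi : ∀ i : Fin 3, Integrable (fun x => fderiv ℝ (fun y => ζ y * radVelQuot (curl u) y) x (EuclideanSpace.single i 1) ^ 2) := fun i =>
      ((continuous_fderiv_apply_of_contDiff hH _).pow 2).integrable_of_hasCompactSupport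
        (hasCompactSupport_of_eq_zero (hHc.fderiv_apply ℝ (EuclideanSpace.single i 1)) fun x hx => by simp [hx])
    rw [hA]; exact ((hi 0).add (hi 1)).add (hi 2)
  have hA0 : ∀ x, 0 ≤ A x := fun x => by rw [hA]; positivity
  have hAeq : ∀ x, ‖gradient (fun y => ζ y * radVelQuot (curl u) y) x‖ ^ 2 = A x := fun x => by
    rw [hA, norm_gradient_sq]
  have hBeq : ∀ x, ‖gradient (fun y => ζ y * radVelQuot u y) x‖ ^ 2 = g 0 x ^ 2 + g 1 x ^ 2 + g 2 x ^ 2 := fun x => by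
    rw [norm_gradient_sq, hgx, hgx, hgx]
  -- `T` vanishes off the ball
  have hfzero : ∀ x, x ∉ closedBall (0 : EuclideanSpace ℝ (Fin 3)) 2 →
      gradient (fun y => ζ y * (ζ y * radVelQuot (curl u) y)) x = 0 := by
    intro x hx
    have hfs : tsupport (fun y => ζ y * (ζ y * radVelQuot (curl u) y)) ⊆ tsupport ζ :=
      tsupport_mul_subset_left
    have h1 : fderiv ℝ (fun y => ζ y * (ζ y * radVelQuot (curl u) y)) x = 0 :=
      fderiv_of_notMem_tsupport ℝ fun h => hx (spaceCyl_subset_closedBall (hζs (hfs h)))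
    simp [gradient, h1]
  have hTzero : ∀ x, x ∉ closedBall (0 : EuclideanSpace ℝ (Fin 3)) 2 → T x = 0 := fun x hx => by
    rw [hT]; simp only; rw [hfzero x hx]; simp [cross]
  -- `T` is integrable (continuous with compact support)
  have hTc : Continuous T := by
    have hgf : Continuous (gradient fun y => ζ y * (ζ y * radVelQuot (curl u) y)) :=
      (InnerProductSpace.toDual ℝ (EuclideanSpace ℝ (Fin 3))).symm.continuous.comp
        (hf1.continuous_fderiv one_ne_zero)
    have hgW : Continuous (gradient (radVelQuot u)) := (contDiff_one_gradient' hW).continuous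
    have : Continuous fun x => ⟪u x, crossCLM (gradient (fun y => ζ y * (ζ y * radVelQuot (curl u) y)) x)
        (gradient (radVelQuot u) x)⟫ :=
      hu1.continuous.inner (crossCLM.continuous₂.comp (hgf.prodMk hgW))
    exact this
  have hTi : Integrable T :=
    hTc.integrable_of_hasCompactSupport (HasCompactSupport.intro (isCompact_closedBall _ _) hTzero)
  -- the pointwise a.e. bound
  have hK0 : 0 ≤ C₁ / (2 * L₁ ^ 2) := by positivity
  have hae : ∀ᵐ x ∂(volume : Measure (EuclideanSpace ℝ (Fin 3))), cylRadius x ≠ 0 := by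
    rw [ae_iff]; simp only [ne_eq, not_not]; exact volume_setOf_cylRadius_eq_zero
  have hTx : ∀ x, T x = ⟪u x, cross (gradient (fun y => ζ y * radVelQuot (curl u) y) x) (gradient (fun y => ζ y * radVelQuot u y) x)⟫ -
      radVelQuot u x * ⟪u x, cross (gradient (fun y => ζ y * radVelQuot (curl u) y) x) (gradient ζ x)⟫ +
      (ζ x * radVelQuot (curl u) x) * ⟪u x, cross (gradient ζ x) (gradient (radVelQuot u) x)⟫ := fun x => by
    rw [hT]; exact hdec x
  have hbound : ∀ᵐ x ∂(volume : Measure (EuclideanSpace ℝ (Fin 3))),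
      |T x| ≤ (C₁ / (2 * L₁ ^ 2) + 2 * ε) * A x + C₁ / (2 * L₁ ^ 2) * (Q 0 x + Q 1 x + Q 2 x) +
        ((P₀ ^ 2 + P₁ ^ 2) / (4 * ε) + P₂) * χ x := by
    filter_upwards [hae] with x hx0
    have hr : 0 < cylRadius x := lt_of_le_of_ne (cylRadius_nonneg x) (Ne.symm hx0)
    have hQsum : 0 ≤ Q 0 x + Q 1 x + Q 2 x := add_nonneg (add_nonneg (hQ0 0 x) (hQ0 1 x)) (hQ0 2 x)
    by_cases hxB : x ∈ closedBall (0 : EuclideanSpace ℝ (Fin 3)) 2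
    swap
    · rw [hTzero x hxB, abs_zero]
      exact add_nonneg (add_nonneg (mul_nonneg (by positivity) (hA0 x)) (mul_nonneg hK0 hQsum))
        (mul_nonneg (by positivity) (hχ0 x))
    have hχx : χ x = 1 := by rw [hχ]; exact indicator_of_mem hxB _
    rw [hχx, mul_one]
    -- `|v_θ| = |swirl|/r`
    have hvθ : |x 0 * u x 1 - x 1 * u x 0| / cylRadius x = |swirlVelocity u x| := by
      have h := swirl_eq_cylRadius_mul_swirlVelocity u hr.ne'
      rw [swirl] at h
      rw [h, abs_mul, abs_of_pos hr, mul_div_cancel_left₀ _ hr.ne']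
    -- the three cross-product bounds
    have h0 := abs_inner_cross_gradient_le _ _ x (u x) hHax hFax hx0 (hHd x) (hFd x)
    have h1 := abs_inner_cross_gradient_le _ _ x (u x) hHax hζax hx0 (hHd x) (hζd x)
    have h2 := abs_inner_cross_gradient_le _ _ x (u x) hζax hWax hx0 (hζd x) (hWd x)
    rw [hvθ] at h0 h1 h2
    rw [norm_gradient_eq_norm_fderiv' ζ] at h1 h2
    rw [norm_gradient_eq_norm_fderiv' (radVelQuot u)] at h2
    -- near / far
    have hcase : |swirlVelocity u x| * (‖gradient (fun y => ζ y * radVelQuot (curl u) y) x‖ * ‖gradient (fun y => ζ y * radVelQuot u y) x‖) ≤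
        C₁ / (2 * L₁ ^ 2) * ‖gradient (fun y => ζ y * radVelQuot (curl u) y) x‖ ^ 2 + C₁ / (2 * L₁ ^ 2) * (Q 0 x + Q 1 x + Q 2 x) ∨
        |swirlVelocity u x| * ‖gradient (fun y => ζ y * radVelQuot u y) x‖ ≤ P₀ := by
      by_cases hnear : cylRadius x < r₁
      · left
        have hsv := abs_swirlVelocity_le_of_swirl_le u x C₁ hr (hσ x hr hnear)
        have hLL : L₁ ≤ Real.log (Real.exp 1 / cylRadius x) := by
          rw [hL₁, log_exp_div_eq _ hr, log_exp_div_eq r₁ hr₁]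
          linarith [Real.log_le_log hr hnear.le]
        have hQxx : Q 0 x + Q 1 x + Q 2 x =
            (‖gradient (fun y => ζ y * radVelQuot u y) x‖ / (cylRadius x * Real.log (Real.exp 1 / cylRadius x))) ^ 2 := by
          rw [hQx, hQx, hQx, ← add_div, ← add_div, ← hBeq x, div_pow, mul_pow]
        rw [hQxx]
        exact near_axis_scalar hsv hr hL₁0 hLL hC₁ (norm_nonneg _) (norm_nonneg _)
      · right
        push Not at hnear
        have := hfar x hnear
        rwa [← norm_gradient_eq_norm_fderiv'] at this
    have hmain := pointwise_scalar h0 h1 h2 (hP1 x) (hP2 x) hε (norm_nonneg _) hK0 hQsum hcase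
    rw [hTx x, ← hAeq x]
    exact hmain
  -- integrate the pointwise bound
  have hQ012 : Integrable (fun x => Q 0 x + Q 1 x + Q 2 x) := ((hQi 0).add (hQi 1)).add (hQi 2)
  have i1 : Integrable (fun x => (C₁ / (2 * L₁ ^ 2) + 2 * ε) * A x) := hAi.const_mul _
  have i2 : Integrable (fun x => C₁ / (2 * L₁ ^ 2) * (Q 0 x + Q 1 x + Q 2 x)) := hQ012.const_mul _
  have i3 : Integrable (fun x => ((P₀ ^ 2 + P₁ ^ 2) / (4 * ε) + P₂) * χ x) := hχi.const_mul _
  have i12 : Integrable (fun x => (C₁ / (2 * L₁ ^ 2) + 2 * ε) * A x +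
      C₁ / (2 * L₁ ^ 2) * (Q 0 x + Q 1 x + Q 2 x)) := i1.add i2
  have hQ01 : Integrable (fun x => Q 0 x + Q 1 x) := (hQi 0).add (hQi 1)
  have i123 : Integrable (fun x => (C₁ / (2 * L₁ ^ 2) + 2 * ε) * A x +
      C₁ / (2 * L₁ ^ 2) * (Q 0 x + Q 1 x + Q 2 x) + ((P₀ ^ 2 + P₁ ^ 2) / (4 * ε) + P₂) * χ x) := i12.add i3
  have hint : ∫ x, |T x| ≤ (C₁ / (2 * L₁ ^ 2) + 2 * ε) * (∫ x, A x) +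
      C₁ / (2 * L₁ ^ 2) * ((∫ x, Q 0 x) + (∫ x, Q 1 x) + ∫ x, Q 2 x) +
      ((P₀ ^ 2 + P₁ ^ 2) / (4 * ε) + P₂) * volume.real (closedBall (0 : EuclideanSpace ℝ (Fin 3)) 2) := by
    have h := integral_mono_ae hTi.abs i123 hbound
    rw [integral_add i12 i3, integral_add i1 i2, MeasureTheory.integral_const_mul,
      MeasureTheory.integral_const_mul, MeasureTheory.integral_const_mul,
      integral_add hQ01 (hQi 2), integral_add (hQi 0) (hQi 1), hχint] at h
    exact h
  -- Lemma 2.2 on the components and Lemma 2.1 (ii)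
  have hgc : ∀ i : Fin 3, HasCompactSupport (g i) := fun i => by rw [hg]; exact hFc.fderiv_apply ℝ _
  have hij : ∀ i j : Fin 3, Integrable (fun x => fderiv ℝ (g i) x (EuclideanSpace.single j 1) ^ 2) := fun i j =>
    ((continuous_fderiv_apply_of_contDiff (hgi i) _).pow 2).integrable_of_hasCompactSupport
      (hasCompactSupport_of_eq_zero ((hgc i).fderiv_apply ℝ (EuclideanSpace.single j 1)) fun x hx => by simp [hx])
  have hR : ∀ i : Fin 3, (∫ x, (fderiv ℝ (g i) x (EuclideanSpace.single 0 1) ^ 2 + fderiv ℝ (g i) x (EuclideanSpace.single 1 1) ^ 2)) ≤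
      ∫ x, ∑ j : Fin 3, (fderiv ℝ (g i) x (EuclideanSpace.single j 1)) ^ 2 := by
    intro i
    refine integral_mono ((hij i 0).add (hij i 1)) (integrable_finsetSum _ fun j _ => hij i j) fun x => ?_
    simp only [Fin.sum_univ_three]
    nlinarith [sq_nonneg (fderiv ℝ (g i) x (EuclideanSpace.single 2 1))]
  have hHessSplit : (∫ x, ∑ i : Fin 3, ∑ j : Fin 3,
      (fderiv ℝ (fun y => fderiv ℝ (fun y => ζ y * radVelQuot u y) y (EuclideanSpace.single i 1)) x (EuclideanSpace.single j 1)) ^ 2) =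
      (∫ x, ∑ j : Fin 3, (fderiv ℝ (g 0) x (EuclideanSpace.single j 1)) ^ 2) +
      (∫ x, ∑ j : Fin 3, (fderiv ℝ (g 1) x (EuclideanSpace.single j 1)) ^ 2) +
      ∫ x, ∑ j : Fin 3, (fderiv ℝ (g 2) x (EuclideanSpace.single j 1)) ^ 2 := by
    have hi : ∀ i : Fin 3, Integrable (fun x => ∑ j : Fin 3, (fderiv ℝ (g i) x (EuclideanSpace.single j 1)) ^ 2) :=
      fun i => integrable_finsetSum _ fun j _ => hij i j
    have hi01 : Integrable (fun x => ∑ j : Fin 3, (fderiv ℝ (g 0) x (EuclideanSpace.single j 1)) ^ 2 +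
        ∑ j : Fin 3, (fderiv ℝ (g 1) x (EuclideanSpace.single j 1)) ^ 2) := (hi 0).add (hi 1)
    rw [← integral_add (hi 0) (hi 1), ← integral_add hi01 (hi 2)]
    refine integral_congr_ae (Eventually.of_forall fun x => ?_)
    rw [hg]
    simp only [Fin.sum_univ_three]
  have hQsum' : (∫ x, Q 0 x) + (∫ x, Q 1 x) + (∫ x, Q 2 x) ≤ 4 * (cL * (∫ x, (fderiv ℝ (fun y => ζ y * angVortQuot u y) x (EuclideanSpace.single 0 1) ^ 2 + fderiv ℝ (fun y => ζ y * angVortQuot u y) x (EuclideanSpace.single 1 1) ^ 2 + fderiv ℝ (fun y => ζ y * angVortQuot u y) x (EuclideanSpace.single 2 1) ^ 2)) + CL) := by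
    have h0 := hQle 0; have h1 := hQle 1; have h2 := hQle 2
    have hR0 := hR 0; have hR1 := hR 1; have hR2 := hR 2
    linarith [hHessSplit, hL21]
  -- assemble
  have hDΦ : (∫ x, A x) = (∫ x, (fderiv ℝ (fun y => ζ y * radVelQuot (curl u) y) x (EuclideanSpace.single 0 1) ^ 2 + fderiv ℝ (fun y => ζ y * radVelQuot (curl u) y) x (EuclideanSpace.single 1 1) ^ 2 + fderiv ℝ (fun y => ζ y * radVelQuot (curl u) y) x (EuclideanSpace.single 2 1) ^ 2)) := by rw [hA]
  have habs : (∫ x, T x) ≤ ∫ x, |T x| := (le_abs_self _).trans abs_integral_le_integral_abs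
  have hDΓ0 : 0 ≤ (∫ x, (fderiv ℝ (fun y => ζ y * angVortQuot u y) x (EuclideanSpace.single 0 1) ^ 2 + fderiv ℝ (fun y => ζ y * angVortQuot u y) x (EuclideanSpace.single 1 1) ^ 2 + fderiv ℝ (fun y => ζ y * angVortQuot u y) x (EuclideanSpace.single 2 1) ^ 2)) := integral_nonneg fun x => by positivity
  have hDΦ0 : 0 ≤ (∫ x, (fderiv ℝ (fun y => ζ y * radVelQuot (curl u) y) x (EuclideanSpace.single 0 1) ^ 2 + fderiv ℝ (fun y => ζ y * radVelQuot (curl u) y) x (EuclideanSpace.single 1 1) ^ 2 + fderiv ℝ (fun y => ζ y * radVelQuot (curl u) y) x (EuclideanSpace.single 2 1) ^ 2)) := integral_nonneg fun x => by positivity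
  rw [hDΦ] at hint
  exact final_scalar habs hint hQsum' hC₁ hL₁0 hε hcL hDΦ0 hDΓ0

end A3

end Summit.NavierStokesRegularity.NavierStokesRegularity.Theorems.AxisymmetricKatoGlobal.EulerScaling

end
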